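import Summits.ValiantsHypothesis.ValiantsHypothesis.Theorems.LacunarySymmetroidMatrixDescartesDoorA26ClosureDominatedTies
import Summits.ValiantsHypothesis.ValiantsHypothesis.Theorems.LacunarySymmetroidMatrixDescartesCensusChamber2182

/-!
# `DoorA26` — (W_gen) FROM A CHAMBER ROW: a decidable face check turns a certified chamber into a generic-Weyl-face closure statement

HONEST FRAMING.  Object-search cell `pub-symmetroid`, door-A target `DoorA26 := PosRootLawAt 2 6 19`
(stmt-ValiantsHypothesis-19979; OPEN, typed, never asserted).  Seat val-sym-door-p2 g16 (#5).  Corollary of #3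
`not_mem_closure_twentyLocus_of_chamber_dominatedTies` (`…DoorA26ClosureDominatedTies`); decides nothing about the door.

THE SCHEMA (`weylFace_not_mem_closure_of_chamber`).  Fix a Weyl face `δᵢ = δᵢ₊₁` (`i : Fin 5`) and a chamber id `n`.  Two side conditions
ON THE TABLE ENTRY ALONE, both `decide`-able: (a) chamber `n` lists canonical pairs; (b) FACE CHECK — whenever two consecutive pairs of chamber
`n` become equal (up to swap) after merging letter `i+1` into letter `i`, the first is dominated by the second (coordinatewise `≤`, `≠`).  Then the
kernel row of chamber `n` gives: every MONOTONE `δ₀` on the face (`δ₀ i = δ₀ (i+1)`) whose pair sums increase weakly along chamber `n` and are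
VALUE-GENERIC OFF THE FACE (two pair sums of `δ₀` coincide only for pairs equal after the merge, up to swap) is outside `closure TwentyLocus`
— i.e. the W-line's `(W_gen)` on the face component refined by chamber `n`, with no analytic door.  Instantiation = `by decide` twice + the
row name; the `example` below does it for face `δ₀ 0 = δ₀ 1` and the certified chamber 2182 (`doorA26_on_chamber2182`, tree).
Located scope (memo `CLOSURE-CENSUS-g16.md`, evidence on 19979): 136 of the 570 generic Weyl-face components have a certified refining chamber today.

Nothing here is a row or a certificate; `DoorA26`, (W), `ConfluentDoor26`, `NoTightChain26NC`, (M), (R), `MatrixDescartes`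
(stmt-ValiantsHypothesis-18050) OPEN; registers unchanged; nothing on `VP ≠ VNP`.  `--supports stmt-ValiantsHypothesis-19979 --as helper`.

[folklore] Elementary bookkeeping; no citation exists or is needed.
-/

-- `Summit.ValiantsHypothesis.ValiantsHypothesis.…` repeats a component by the D-0017 layout
-- (single-conjunct summit), which the `dupNamespace` linter flags; the name is mandated.
set_option linter.dupNamespace false

namespace Summit.ValiantsHypothesis.ValiantsHypothesis.Theorems.LacunarySymmetroidMatrixDescartes.Census.RealExp

open Summit.ValiantsHypothesis.ValiantsHypothesis.Theorems.LacunarySymmetroidMatrixDescartes.WallBubbling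

/-- **(W_gen) FROM A CHAMBER ROW — the schema.**  Face `δ₀ i.castSucc = δ₀ i.succ`; `merge` sends letter `i.succ` to `i.castSucc`; (a) canonicity and
(b) the face check are decidable on the table entry `chamber n`; `hrow` := the landed row; `hmono` places `δ₀` in the closed cone of chamber `n`,
`hgen` is value-genericity off the face.  Conclusion: `δ₀ ∉ closure TwentyLocus`. [this work] -/
theorem weylFace_not_mem_closure_of_chamber (i : Fin 5) (n : ℕ)
    (hcanon : ∀ t, (chamber n t).1 ≤ (chamber n t).2)
    (hdom : ∀ t : Fin 20,
      (((fun x : Fin 6 => if x = i.succ then i.castSucc else x) (chamber n t.castSucc).1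
            = (fun x : Fin 6 => if x = i.succ then i.castSucc else x) (chamber n t.succ).1 ∧
          (fun x : Fin 6 => if x = i.succ then i.castSucc else x) (chamber n t.castSucc).2
            = (fun x : Fin 6 => if x = i.succ then i.castSucc else x) (chamber n t.succ).2) ∨
        ((fun x : Fin 6 => if x = i.succ then i.castSucc else x) (chamber n t.castSucc).1
            = (fun x : Fin 6 => if x = i.succ then i.castSucc else x) (chamber n t.succ).2 ∧
          (fun x : Fin 6 => if x = i.succ then i.castSucc else x) (chamber n t.castSucc).2
            = (fun x : Fin 6 => if x = i.succ then i.castSucc else x) (chamber n t.succ).1)) →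
      (chamber n t.castSucc).1 ≤ (chamber n t.succ).1 ∧ (chamber n t.castSucc).2 ≤ (chamber n t.succ).2 ∧
        chamber n t.castSucc ≠ chamber n t.succ)
    (hrow : ∀ d : Fin 6 → ℕ, StrictMono ((fun p : Fin 6 × Fin 6 => d p.1 + d p.2) ∘ chamber n) → PosRootLawOn 2 6 19 d)
    (δ₀ : Fin 6 → ℝ) (hδ₀ : Monotone δ₀)
    (hmono : Monotone ((fun p : Fin 6 × Fin 6 => δ₀ p.1 + δ₀ p.2) ∘ chamber n))
    (hgen : ∀ p q : Fin 6 × Fin 6, p.1 ≤ p.2 → q.1 ≤ q.2 → δ₀ p.1 + δ₀ p.2 = δ₀ q.1 + δ₀ q.2 →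
      (((fun x : Fin 6 => if x = i.succ then i.castSucc else x) p.1 = (fun x : Fin 6 => if x = i.succ then i.castSucc else x) q.1 ∧
          (fun x : Fin 6 => if x = i.succ then i.castSucc else x) p.2 = (fun x : Fin 6 => if x = i.succ then i.castSucc else x) q.2) ∨
        ((fun x : Fin 6 => if x = i.succ then i.castSucc else x) p.1 = (fun x : Fin 6 => if x = i.succ then i.castSucc else x) q.2 ∧
          (fun x : Fin 6 => if x = i.succ then i.castSucc else x) p.2 = (fun x : Fin 6 => if x = i.succ then i.castSucc else x) q.1))) :
    δ₀ ∉ closure {δ : Fin 6 → ℝ | ∃ S : Fin 6 → Matrix (Fin 2) (Fin 2) ℝ, (∀ l, (S l).IsSymm) ∧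
      20 ≤ {x : ℝ | 0 < x ∧ (∑ l, (x ^ (δ l)) • S l).det = 0}.ncard} :=
  not_mem_closure_twentyLocus_of_chamber_dominatedTies δ₀ hδ₀ n hcanon hmono
    (fun t ht => hdom t (hgen _ _ (hcanon _) (hcanon _) ht)) hrow

/-- **W-line currency.**  Same schema with conclusion `δ₀ ∉ closure Bubbling.TwentyLocus` — the statement `(W_gen)` of
`Cruxes/DoorA26/Lines/wall_bubbling_ConfluentDoor.lean` on the face component refined by chamber `n`. [this work] -/
theorem weylFace_not_mem_closure_bubblingTwentyLocus_of_chamber (i : Fin 5) (n : ℕ)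
    (hcanon : ∀ t, (chamber n t).1 ≤ (chamber n t).2)
    (hdom : ∀ t : Fin 20,
      (((fun x : Fin 6 => if x = i.succ then i.castSucc else x) (chamber n t.castSucc).1
            = (fun x : Fin 6 => if x = i.succ then i.castSucc else x) (chamber n t.succ).1 ∧
          (fun x : Fin 6 => if x = i.succ then i.castSucc else x) (chamber n t.castSucc).2
            = (fun x : Fin 6 => if x = i.succ then i.castSucc else x) (chamber n t.succ).2) ∨
        ((fun x : Fin 6 => if x = i.succ then i.castSucc else x) (chamber n t.castSucc).1
            = (fun x : Fin 6 => if x = i.succ then i.castSucc else x) (chamber n t.succ).2 ∧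
          (fun x : Fin 6 => if x = i.succ then i.castSucc else x) (chamber n t.castSucc).2
            = (fun x : Fin 6 => if x = i.succ then i.castSucc else x) (chamber n t.succ).1)) →
      (chamber n t.castSucc).1 ≤ (chamber n t.succ).1 ∧ (chamber n t.castSucc).2 ≤ (chamber n t.succ).2 ∧
        chamber n t.castSucc ≠ chamber n t.succ)
    (hrow : ∀ d : Fin 6 → ℕ, StrictMono ((fun p : Fin 6 × Fin 6 => d p.1 + d p.2) ∘ chamber n) → PosRootLawOn 2 6 19 d)
    (δ₀ : Fin 6 → ℝ) (hδ₀ : Monotone δ₀)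
    (hmono : Monotone ((fun p : Fin 6 × Fin 6 => δ₀ p.1 + δ₀ p.2) ∘ chamber n))
    (hgen : ∀ p q : Fin 6 × Fin 6, p.1 ≤ p.2 → q.1 ≤ q.2 → δ₀ p.1 + δ₀ p.2 = δ₀ q.1 + δ₀ q.2 →
      (((fun x : Fin 6 => if x = i.succ then i.castSucc else x) p.1 = (fun x : Fin 6 => if x = i.succ then i.castSucc else x) q.1 ∧
          (fun x : Fin 6 => if x = i.succ then i.castSucc else x) p.2 = (fun x : Fin 6 => if x = i.succ then i.castSucc else x) q.2) ∨
        ((fun x : Fin 6 => if x = i.succ then i.castSucc else x) p.1 = (fun x : Fin 6 => if x = i.succ then i.castSucc else x) q.2 ∧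
          (fun x : Fin 6 => if x = i.succ then i.castSucc else x) p.2 = (fun x : Fin 6 => if x = i.succ then i.castSucc else x) q.1))) :
    δ₀ ∉ closure Bubbling.TwentyLocus :=
  weylFace_not_mem_closure_of_chamber i n hcanon hdom hrow δ₀ hδ₀ hmono hgen

/-- **Worked instance** (face `δ₀ 0 = δ₀ 1`, the certified chamber 2182 — the unique refining chamber of the generic face component with reduced
letter values `(0,7,11,13,16)` in the located census): both table-side conditions by `decide`, the row by name (`doorA26_on_chamber2182`). [this work] -/
theorem weylFace01_not_mem_closure_chamber2182 (δ₀ : Fin 6 → ℝ) (hδ₀ : Monotone δ₀)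
    (hmono : Monotone ((fun p : Fin 6 × Fin 6 => δ₀ p.1 + δ₀ p.2) ∘ chamber 2182))
    (hgen : ∀ p q : Fin 6 × Fin 6, p.1 ≤ p.2 → q.1 ≤ q.2 → δ₀ p.1 + δ₀ p.2 = δ₀ q.1 + δ₀ q.2 →
      (((fun x : Fin 6 => if x = (0 : Fin 5).succ then (0 : Fin 5).castSucc else x) p.1
            = (fun x : Fin 6 => if x = (0 : Fin 5).succ then (0 : Fin 5).castSucc else x) q.1 ∧
          (fun x : Fin 6 => if x = (0 : Fin 5).succ then (0 : Fin 5).castSucc else x) p.2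
            = (fun x : Fin 6 => if x = (0 : Fin 5).succ then (0 : Fin 5).castSucc else x) q.2) ∨
        ((fun x : Fin 6 => if x = (0 : Fin 5).succ then (0 : Fin 5).castSucc else x) p.1
            = (fun x : Fin 6 => if x = (0 : Fin 5).succ then (0 : Fin 5).castSucc else x) q.2 ∧
          (fun x : Fin 6 => if x = (0 : Fin 5).succ then (0 : Fin 5).castSucc else x) p.2
            = (fun x : Fin 6 => if x = (0 : Fin 5).succ then (0 : Fin 5).castSucc else x) q.1))) :
    δ₀ ∉ closure Bubbling.TwentyLocus :=
  weylFace_not_mem_closure_bubblingTwentyLocus_of_chamber 0 2182 (by decide) (by decide)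
    (fun d hd => doorA26_on_chamber2182 d hd) δ₀ hδ₀ hmono hgen

end Summit.ValiantsHypothesis.ValiantsHypothesis.Theorems.LacunarySymmetroidMatrixDescartes.Census.RealExp
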